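import Summits.BirchSwinnertonDyer.BirchSwinnertonDyer.Theorems.PrintCFramJZeroThreeUnitRegimePrimePair
import Summits.BirchSwinnertonDyer.Rank1Residual.X12.O11.RouteUEulerCriterionNat
import Mathlib.Tactic.NormNum.LegendreSymbol
import HarnessLib

/-! # K12r@3 — the «3-unit regime» CLASS THEOREMS for the prime pairs `(17, −47)` [7803a/b/c],
# `(41, −23)` [15129a] and `(5, −59)` [11025a/b]: instances of `bsdp_three_of_unitRegime_prime_pair`
# with the two Bernoulli certificates DECIDED in the kernel (cell `bsd-print-cfram`, seat p3 g2;
# regime N = `TorsionFreeFrameBSDThree`, stmt-BirchSwinnertonDyer-20698; P3-UNIT-REGIME-CENSUS §5 RECIPE)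

HONEST FRAMING (cell `bsd-print-cfram`, run/shared/lean/pub/bsd-print-cfram/, D-0131 (2) print
tier; verbatim in every file of the cell): the cell works the partition leaf
`CornerF ∧ p ramified in the CM field K` (LADDER-BSD row K7r = B13; W-ALL row 12r) in PARTITION
currency — a leaf or a cell counts only when its theorem is in the kernel BY NAME. Nothing here is a
Literature statement, no named fact is introduced, nothing is asserted about BSD; beyond-print: NO
(Kriz–Li 2019 Thm. 1.20 + Rem. 3.10 at `p = 3`, §10.3's mechanism; finite certificates by `decide`).

For each pair `(q, r)`: §1 the two INTEGER CERTIFICATES of `…PrimePairBernoulli` —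
`3 ∤ S₁(q,r) = Σ_{j<qr} (j/q)(j/r)·j` and `3 ∥ S₂(q) = Σ_{j<3q} (j/q)(j/3)·j` (`decide +kernel` on
Euler's criterion in `ℕ`-arithmetic, bsd-cm `RouteU.jacobiSym_prime_eq_ite_nat`, Jacobi form — no `Fact`
instances needed, THEOREMS ONLY; values `S₁(17,47) = −12784 = −799·h(−799)`,
`S₂(17) = −102`; `S₁(41,23) = −15088 = −943·h(−943)`, `S₂(41) = −246`; `S₁(5,59) = −2360 =
−295·h(−295)`, `S₂(5) = −30`); §2 the CLASS THEOREM `bsdp_three_of_unitRegime_<q>_<r>` =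
`bsdp_three_of_unitRegime_prime_pair` with `q % 4 = 1`, `r % 4 = 3`, `J(3 | q) = −1`,
`J(−r | 3) = J(−r | q) = 1` (and for `11025`: `ℓ = 7`, `7 ≡ 1 (3)`, `J(7 | 5) = −1`, `J(−59 | 7) = 1`)
by `norm_num` (Mathlib's Jacobi-symbol extension). Binders = those of
`bsdp_three_of_unitRegime_five_eleven` (p546876) with the numerals changed: BSD(W, 3) for every
globally minimal `W ≅ y² = x³ + q·m²` (`qm²` sixth-power-free) of analytic rank one with bad primes in
the listed set and a Heegner field of discriminant `−r`; displayed = Route U's data, PUB facts, twin,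
certificate binders `htamW`/`hSW`/`hSd`, level-`0` generator, `hW`/`h6`/`h2`/`hS`.
Reach (P3-UNIT-REGIME-CENSUS §0/§2; all six classes are regime N by p546152's criterion): `7803a1`,
`7803b1`, `7803c1` (k = 17·68², 17·4², 17·1156²), `15129a1` (k = 41·4²), `11025a1`, `11025b1`
(k = 5·4900², 5·140²; bad primes `{3, 5, 7}`) — `7803b1`, `15129a1` already booked by print,
`7803a1`, `7803c1`, `11025a1`, `11025b1` UNBOOKED before.
References: [KrizLi2019] Thm. 1.20 (pp. 7–8), Rem. 3.10 (p. 26), Thm. 1.23, §1.5 (1), §10.3;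
[Washington1997] Thm. 4.2; [GrossZagier1986] V.§2; [Miller2011LMS] Def. 1.1.
-/

set_option linter.dupNamespace false
set_option autoImplicit false

noncomputable section

open scoped Classical
open NumberField Field WeierstrassCurve DirichletCharacter
open Literature.NumberTheory.EllipticCurves Literature.NumberTheory.EllipticCurves.KrizLi2019
  Literature.NumberTheory.EllipticCurves.ModularForms Literature.NumberTheory.QuadraticFields
  Summit.BirchSwinnertonDyer.Rank1Residual.X12.O11.RouteU

namespace Summit.BirchSwinnertonDyer.BirchSwinnertonDyer.Theorems.PrintCFram


/-! ## `(q, r) = (17, 47)`: certificates and the class theorem [7803a, 7803b, 7803c] -/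

set_option maxRecDepth 200000 in
/-- **CERTIFICATE `3 ∤ S₁(17,47)`**, `S₁ = Σ_{j<799} (j/17)(j/47)·j = -12784` (`decide` on Euler's
criterion, Jacobi form). [cite: KrizLi2019, Thm. 1.20 (p. 8) and §1.5 (1)] [cite: Washington1997, Thm. 4.2] -/
theorem certOne_seventeen_fortySeven :
    ¬ ((3 : ℤ) ∣ ∑ j ∈ Finset.range (17 * 47),
      jacobiSym (j : ℤ) 17 * jacobiSym (j : ℤ) 47 * (j : ℤ)) := by
  simp_rw [jacobiSym_prime_eq_ite_nat 17 (by norm_num) (by norm_num),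
    jacobiSym_prime_eq_ite_nat 47 (by norm_num) (by norm_num)]
  decide +kernel

set_option maxRecDepth 200000 in
/-- **CERTIFICATE `3 ∥ S₂(17)`**, `S₂ = Σ_{j<51} (j/17)(j/3)·j = -102`: `3 ∣ S₂` and `9 ∤ S₂`
(`decide`). [cite: KrizLi2019, Thm. 1.20 (p. 8) and §1.5 (1)] [cite: Washington1997, Thm. 4.2] -/
theorem certTwo_seventeen :
    ((3 : ℤ) ∣ ∑ j ∈ Finset.range (17 * 3),
      jacobiSym (j : ℤ) 17 * jacobiSym (j : ℤ) 3 * (j : ℤ) ^ (0 + 1)) ∧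
    ¬ ((3 : ℤ) ^ 2 ∣ ∑ j ∈ Finset.range (17 * 3),
      jacobiSym (j : ℤ) 17 * jacobiSym (j : ℤ) 3 * (j : ℤ) ^ (0 + 1)) := by
  simp_rw [jacobiSym_prime_eq_ite_nat 17 (by norm_num) (by norm_num),
    jacobiSym_prime_eq_ite_nat 3 (by norm_num) (by norm_num)]
  constructor
  · decide +kernel
  · decide +kernel

/-- **BSD(W, 3) in the 3-UNIT REGIME for `(d, d_K) = (17, −47)`** [7803a, 7803b, 7803c] — for every
globally minimal `W/ℚ` of analytic rank one with `C • W = y² = x³ + 17·m²` (`m ∈ ℤ`, `17m²`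
sixth-power-free), bad primes `⊂ {3, 17}`, `a₂(W) = 0` if `W` is good at `2`, and an imaginary
quadratic `K` with `d_K = −47`: `bsdp_three_of_unitRegime_prime_pair` with `ψ = (·/17)`,
`ε_K = (·/47)↑`, its decidable numerics and the two certificates above discharged; the displayed
binders are Route U's data, PUB facts and certificates (as in `bsdp_three_of_unitRegime_five_eleven`).
[cite: KrizLi2019, Thm. 1.20 (pp. 7–8), Rem. 3.10 (p. 26), §10.3]
[cite: GrossZagier1986, V.§2 (pp. 310–312)] [cite: Miller2011LMS, Def. 1.1] -/
theorem bsdp_three_of_unitRegime_seventeen_fortySeven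
    (hKL : KrizLi2019.thm120_padicLogHeegner_unit_of_bernoulli)
    (hRem : KrizLi2019.rem310_padicLogHeegner_integral)
    (W : WeierstrassCurve ℚ) [W.IsElliptic] [W.IsGloballyMinimal] [NeZero (W.conductorNorm ℤ)]
    {m : ℤ} (hm : m ≠ 0) (hW : ∃ C : VariableChange ℚ, C • W = mordellCurve ((17 : ℤ) * (m : ℚ) ^ 2))
    (h6 : ∀ ℓ : ℕ, ℓ.Prime → ¬ ((ℓ : ℤ) ^ 6 ∣ 17 * m ^ 2))
    (h2 : (haveI : Fact (Nat.Prime 2) := ⟨Nat.prime_two⟩; W.HasGoodReductionAtPrime 2) →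
      W.LFunction 2 = 0)
    (hS : ∀ ℓ : ℕ, (hℓ : ℓ.Prime) → ¬ (haveI := Fact.mk hℓ; W.HasGoodReductionAtPrime ℓ) →
      ℓ = 3 ∨ ℓ = 17)
    (K : Type) [Field K] [NumberField K] [NeZero (NumberField.discr K).natAbs]
    (hK : IsImaginaryQuadratic K) (hdK : NumberField.discr K = -47)
    (D : ModularParametrizationData W (W.conductorNorm ℤ))
    (H : HeegnerDatum (W.conductorNorm ℤ) (NumberField.discr K)) (ι : K →+* ℂ)
    (ιp : K →+* ℚ_[3]) (P : (W.baseChange K).toAffine.Point)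
    (hGZ : gross_zagier (W.conductorNorm ℤ) W K) (hKo : kolyvagin (W.conductorNorm ℤ) W K)
    (hGZK : rank_eq_analyticRank_of_analyticRank_le_one) (hmod : hasEntireLFunction_rat)
    (hP : WeierstrassCurve.Affine.Point.map ι.toRatAlgHom P = heegnerPointComplex D H)
    (hr : W.analyticRank = 1)
    (hLt : (W.quadraticTwist (NumberField.discr K : ℚ)).entireLFunction 1 ≠ 0)
    (Wd : WeierstrassCurve ℚ) [Wd.IsElliptic] [Wd.IsGloballyMinimal] (Cd : VariableChange ℚ)
    (hWd : Cd • W.quadraticTwist (NumberField.discr K : ℚ) = Wd)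
    (htw : ∃ q : ℚ, Wd.entireLFunction 1 / (Wd.realPeriodRat : ℂ) = (q : ℂ) ∧
      padicValRat 3 q = (padicValNat 3 Wd.shaOrder : ℤ) + padicValNat 3 Wd.tamagawaProduct -
        2 * padicValNat 3 Wd.torsionOrder)
    (htam : padicValNat 3 Wd.tamagawaProduct = padicValNat 3 W.tamagawaProduct)
    (hu : padicValRat 3 (Cd.u : ℚ) = 0)
    (htamW : ¬ 3 ∣ W.tamagawaProduct)
    (hSW : ∀ [Finite W.sha], ¬ 3 ∣ W.shaOrder) (hSd : ∀ [Finite Wd.sha], ¬ 3 ∣ Wd.shaOrder)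
    (ω : DirichletCharacter ℚ_[3] 3) (hω : KrizLi2019.IsTeichmullerCharacter ω)
    [Finite (AddCommGroup.torsion (W.baseChange K).toAffine.Point)]
    (crd : (W.baseChange K).toAffine.Point →+ ℤ) (g : (W.baseChange K).toAffine.Point)
    (hg : crd g = 1) (hker : ∀ x, crd x = 0 → IsOfFinAddOrder x)
    (hiv : ∀ x : (W.baseChange K).toAffine.Point, 3 • x = 0 → x = 0)
    (hg0 : ‖Castella2018.padicLogOmega W 3 ιp g‖ = 1) :
    BSDp W 3 := by
  haveI : Fact (Nat.Prime 17) := ⟨by norm_num⟩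
  haveI : Fact (Nat.Prime 47) := ⟨by norm_num⟩
  exact bsdp_three_of_unitRegime_prime_pair hKL hRem (q := 17) (r := 47) (by norm_num) (by norm_num)
    (by norm_num) (by norm_num) (by norm_num) (by norm_num)
    (by simp_rw [jacobiSym.legendreSym.to_jacobiSym]; exact certOne_seventeen_fortySeven)
    (by simp_rw [jacobiSym.legendreSym.to_jacobiSym]; exact certTwo_seventeen.1)
    (by simp_rw [jacobiSym.legendreSym.to_jacobiSym]; exact certTwo_seventeen.2)
    W hm (by exact_mod_cast hW) (by exact_mod_cast h6) h2
    (fun ℓ hℓ hbad => (hS ℓ hℓ hbad).elim Or.inl fun h => Or.inr (Or.inl h))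
    K hK (by rw [hdK]; norm_num) D H ι ιp P hGZ hKo hGZK hmod hP hr hLt Wd Cd hWd htw htam hu htamW
    hSW hSd ω hω crd g hg hker hiv hg0

/-! ## `(q, r) = (41, 23)`: certificates and the class theorem [15129a] -/

set_option maxRecDepth 200000 in
/-- **CERTIFICATE `3 ∤ S₁(41,23)`**, `S₁ = Σ_{j<943} (j/41)(j/23)·j = -15088` (`decide` on Euler's
criterion, Jacobi form). [cite: KrizLi2019, Thm. 1.20 (p. 8) and §1.5 (1)] [cite: Washington1997, Thm. 4.2] -/
theorem certOne_fortyOne_twentyThree :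
    ¬ ((3 : ℤ) ∣ ∑ j ∈ Finset.range (41 * 23),
      jacobiSym (j : ℤ) 41 * jacobiSym (j : ℤ) 23 * (j : ℤ)) := by
  simp_rw [jacobiSym_prime_eq_ite_nat 41 (by norm_num) (by norm_num),
    jacobiSym_prime_eq_ite_nat 23 (by norm_num) (by norm_num)]
  decide +kernel

set_option maxRecDepth 200000 in
/-- **CERTIFICATE `3 ∥ S₂(41)`**, `S₂ = Σ_{j<123} (j/41)(j/3)·j = -246`: `3 ∣ S₂` and `9 ∤ S₂`
(`decide`). [cite: KrizLi2019, Thm. 1.20 (p. 8) and §1.5 (1)] [cite: Washington1997, Thm. 4.2] -/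
theorem certTwo_fortyOne :
    ((3 : ℤ) ∣ ∑ j ∈ Finset.range (41 * 3),
      jacobiSym (j : ℤ) 41 * jacobiSym (j : ℤ) 3 * (j : ℤ) ^ (0 + 1)) ∧
    ¬ ((3 : ℤ) ^ 2 ∣ ∑ j ∈ Finset.range (41 * 3),
      jacobiSym (j : ℤ) 41 * jacobiSym (j : ℤ) 3 * (j : ℤ) ^ (0 + 1)) := by
  simp_rw [jacobiSym_prime_eq_ite_nat 41 (by norm_num) (by norm_num),
    jacobiSym_prime_eq_ite_nat 3 (by norm_num) (by norm_num)]
  constructor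
  · decide +kernel
  · decide +kernel

/-- **BSD(W, 3) in the 3-UNIT REGIME for `(d, d_K) = (41, −23)`** [15129a] — for every
globally minimal `W/ℚ` of analytic rank one with `C • W = y² = x³ + 41·m²` (`m ∈ ℤ`, `41m²`
sixth-power-free), bad primes `⊂ {3, 41}`, `a₂(W) = 0` if `W` is good at `2`, and an imaginary
quadratic `K` with `d_K = −23`: `bsdp_three_of_unitRegime_prime_pair` with `ψ = (·/41)`,
`ε_K = (·/23)↑`, its decidable numerics and the two certificates above discharged; the displayed
binders are Route U's data, PUB facts and certificates (as in `bsdp_three_of_unitRegime_five_eleven`).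
[cite: KrizLi2019, Thm. 1.20 (pp. 7–8), Rem. 3.10 (p. 26), §10.3]
[cite: GrossZagier1986, V.§2 (pp. 310–312)] [cite: Miller2011LMS, Def. 1.1] -/
theorem bsdp_three_of_unitRegime_fortyOne_twentyThree
    (hKL : KrizLi2019.thm120_padicLogHeegner_unit_of_bernoulli)
    (hRem : KrizLi2019.rem310_padicLogHeegner_integral)
    (W : WeierstrassCurve ℚ) [W.IsElliptic] [W.IsGloballyMinimal] [NeZero (W.conductorNorm ℤ)]
    {m : ℤ} (hm : m ≠ 0) (hW : ∃ C : VariableChange ℚ, C • W = mordellCurve ((41 : ℤ) * (m : ℚ) ^ 2))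
    (h6 : ∀ ℓ : ℕ, ℓ.Prime → ¬ ((ℓ : ℤ) ^ 6 ∣ 41 * m ^ 2))
    (h2 : (haveI : Fact (Nat.Prime 2) := ⟨Nat.prime_two⟩; W.HasGoodReductionAtPrime 2) →
      W.LFunction 2 = 0)
    (hS : ∀ ℓ : ℕ, (hℓ : ℓ.Prime) → ¬ (haveI := Fact.mk hℓ; W.HasGoodReductionAtPrime ℓ) →
      ℓ = 3 ∨ ℓ = 41)
    (K : Type) [Field K] [NumberField K] [NeZero (NumberField.discr K).natAbs]
    (hK : IsImaginaryQuadratic K) (hdK : NumberField.discr K = -23)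
    (D : ModularParametrizationData W (W.conductorNorm ℤ))
    (H : HeegnerDatum (W.conductorNorm ℤ) (NumberField.discr K)) (ι : K →+* ℂ)
    (ιp : K →+* ℚ_[3]) (P : (W.baseChange K).toAffine.Point)
    (hGZ : gross_zagier (W.conductorNorm ℤ) W K) (hKo : kolyvagin (W.conductorNorm ℤ) W K)
    (hGZK : rank_eq_analyticRank_of_analyticRank_le_one) (hmod : hasEntireLFunction_rat)
    (hP : WeierstrassCurve.Affine.Point.map ι.toRatAlgHom P = heegnerPointComplex D H)
    (hr : W.analyticRank = 1)
    (hLt : (W.quadraticTwist (NumberField.discr K : ℚ)).entireLFunction 1 ≠ 0)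
    (Wd : WeierstrassCurve ℚ) [Wd.IsElliptic] [Wd.IsGloballyMinimal] (Cd : VariableChange ℚ)
    (hWd : Cd • W.quadraticTwist (NumberField.discr K : ℚ) = Wd)
    (htw : ∃ q : ℚ, Wd.entireLFunction 1 / (Wd.realPeriodRat : ℂ) = (q : ℂ) ∧
      padicValRat 3 q = (padicValNat 3 Wd.shaOrder : ℤ) + padicValNat 3 Wd.tamagawaProduct -
        2 * padicValNat 3 Wd.torsionOrder)
    (htam : padicValNat 3 Wd.tamagawaProduct = padicValNat 3 W.tamagawaProduct)
    (hu : padicValRat 3 (Cd.u : ℚ) = 0)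
    (htamW : ¬ 3 ∣ W.tamagawaProduct)
    (hSW : ∀ [Finite W.sha], ¬ 3 ∣ W.shaOrder) (hSd : ∀ [Finite Wd.sha], ¬ 3 ∣ Wd.shaOrder)
    (ω : DirichletCharacter ℚ_[3] 3) (hω : KrizLi2019.IsTeichmullerCharacter ω)
    [Finite (AddCommGroup.torsion (W.baseChange K).toAffine.Point)]
    (crd : (W.baseChange K).toAffine.Point →+ ℤ) (g : (W.baseChange K).toAffine.Point)
    (hg : crd g = 1) (hker : ∀ x, crd x = 0 → IsOfFinAddOrder x)
    (hiv : ∀ x : (W.baseChange K).toAffine.Point, 3 • x = 0 → x = 0)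
    (hg0 : ‖Castella2018.padicLogOmega W 3 ιp g‖ = 1) :
    BSDp W 3 := by
  haveI : Fact (Nat.Prime 41) := ⟨by norm_num⟩
  haveI : Fact (Nat.Prime 23) := ⟨by norm_num⟩
  exact bsdp_three_of_unitRegime_prime_pair hKL hRem (q := 41) (r := 23) (by norm_num) (by norm_num)
    (by norm_num) (by norm_num) (by norm_num) (by norm_num)
    (by simp_rw [jacobiSym.legendreSym.to_jacobiSym]; exact certOne_fortyOne_twentyThree)
    (by simp_rw [jacobiSym.legendreSym.to_jacobiSym]; exact certTwo_fortyOne.1)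
    (by simp_rw [jacobiSym.legendreSym.to_jacobiSym]; exact certTwo_fortyOne.2)
    W hm (by exact_mod_cast hW) (by exact_mod_cast h6) h2
    (fun ℓ hℓ hbad => (hS ℓ hℓ hbad).elim Or.inl fun h => Or.inr (Or.inl h))
    K hK (by rw [hdK]; norm_num) D H ι ιp P hGZ hKo hGZK hmod hP hr hLt Wd Cd hWd htw htam hu htamW
    hSW hSd ω hω crd g hg hker hiv hg0

/-! ## `(q, r) = (5, 59)`: certificates and the class theorem [11025a, 11025b] -/

set_option maxRecDepth 200000 in
/-- **CERTIFICATE `3 ∤ S₁(5,59)`**, `S₁ = Σ_{j<295} (j/5)(j/59)·j = -2360` (`decide` on Euler's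
criterion, Jacobi form). [cite: KrizLi2019, Thm. 1.20 (p. 8) and §1.5 (1)] [cite: Washington1997, Thm. 4.2] -/
theorem certOne_five_fiftyNine :
    ¬ ((3 : ℤ) ∣ ∑ j ∈ Finset.range (5 * 59),
      jacobiSym (j : ℤ) 5 * jacobiSym (j : ℤ) 59 * (j : ℤ)) := by
  simp_rw [jacobiSym_prime_eq_ite_nat 5 (by norm_num) (by norm_num),
    jacobiSym_prime_eq_ite_nat 59 (by norm_num) (by norm_num)]
  decide +kernel

set_option maxRecDepth 20000 in
/-- **CERTIFICATE `3 ∥ S₂(5)`**, `S₂ = Σ_{j<15} (j/5)(j/3)·j = −30`: `3 ∣ S₂` and `9 ∤ S₂` (`decide`;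
the same finite fact as `norm_generalizedBernoulli_thetaTwo_five`, p546318, in the generic currency).
[cite: KrizLi2019, Thm. 1.20 (p. 8) and §1.5 (1)] [cite: Washington1997, Thm. 4.2] -/
theorem certTwo_five :
    ((3 : ℤ) ∣ ∑ j ∈ Finset.range (5 * 3),
      jacobiSym (j : ℤ) 5 * jacobiSym (j : ℤ) 3 * (j : ℤ) ^ (0 + 1)) ∧
    ¬ ((3 : ℤ) ^ 2 ∣ ∑ j ∈ Finset.range (5 * 3),
      jacobiSym (j : ℤ) 5 * jacobiSym (j : ℤ) 3 * (j : ℤ) ^ (0 + 1)) := by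
  simp_rw [jacobiSym_prime_eq_ite_nat 5 (by norm_num) (by norm_num),
    jacobiSym_prime_eq_ite_nat 3 (by norm_num) (by norm_num)]
  constructor
  · decide +kernel
  · decide +kernel

/-- **BSD(W, 3) in the 3-UNIT REGIME for `(d, d_K) = (5, −59)`** [11025a, 11025b] — for every
globally minimal `W/ℚ` of analytic rank one with `C • W = y² = x³ + 5·m²` (`m ∈ ℤ`, `5m²`
sixth-power-free), bad primes `⊂ {3, 5, 7}`, `a₂(W) = 0` if `W` is good at `2`, and an imaginary
quadratic `K` with `d_K = −59`: `bsdp_three_of_unitRegime_prime_pair` with `ψ = (·/5)`,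
`ε_K = (·/59)↑`, its decidable numerics and the two certificates above discharged; the displayed
binders are Route U's data, PUB facts and certificates (as in `bsdp_three_of_unitRegime_five_eleven`).
[cite: KrizLi2019, Thm. 1.20 (pp. 7–8), Rem. 3.10 (p. 26), §10.3]
[cite: GrossZagier1986, V.§2 (pp. 310–312)] [cite: Miller2011LMS, Def. 1.1] -/
theorem bsdp_three_of_unitRegime_five_fiftyNine
    (hKL : KrizLi2019.thm120_padicLogHeegner_unit_of_bernoulli)
    (hRem : KrizLi2019.rem310_padicLogHeegner_integral)
    (W : WeierstrassCurve ℚ) [W.IsElliptic] [W.IsGloballyMinimal] [NeZero (W.conductorNorm ℤ)]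
    {m : ℤ} (hm : m ≠ 0) (hW : ∃ C : VariableChange ℚ, C • W = mordellCurve ((5 : ℤ) * (m : ℚ) ^ 2))
    (h6 : ∀ ℓ : ℕ, ℓ.Prime → ¬ ((ℓ : ℤ) ^ 6 ∣ 5 * m ^ 2))
    (h2 : (haveI : Fact (Nat.Prime 2) := ⟨Nat.prime_two⟩; W.HasGoodReductionAtPrime 2) →
      W.LFunction 2 = 0)
    (hS : ∀ ℓ : ℕ, (hℓ : ℓ.Prime) → ¬ (haveI := Fact.mk hℓ; W.HasGoodReductionAtPrime ℓ) →
      ℓ = 3 ∨ ℓ = 5 ∨ ℓ = 7)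
    (K : Type) [Field K] [NumberField K] [NeZero (NumberField.discr K).natAbs]
    (hK : IsImaginaryQuadratic K) (hdK : NumberField.discr K = -59)
    (D : ModularParametrizationData W (W.conductorNorm ℤ))
    (H : HeegnerDatum (W.conductorNorm ℤ) (NumberField.discr K)) (ι : K →+* ℂ)
    (ιp : K →+* ℚ_[3]) (P : (W.baseChange K).toAffine.Point)
    (hGZ : gross_zagier (W.conductorNorm ℤ) W K) (hKo : kolyvagin (W.conductorNorm ℤ) W K)
    (hGZK : rank_eq_analyticRank_of_analyticRank_le_one) (hmod : hasEntireLFunction_rat)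
    (hP : WeierstrassCurve.Affine.Point.map ι.toRatAlgHom P = heegnerPointComplex D H)
    (hr : W.analyticRank = 1)
    (hLt : (W.quadraticTwist (NumberField.discr K : ℚ)).entireLFunction 1 ≠ 0)
    (Wd : WeierstrassCurve ℚ) [Wd.IsElliptic] [Wd.IsGloballyMinimal] (Cd : VariableChange ℚ)
    (hWd : Cd • W.quadraticTwist (NumberField.discr K : ℚ) = Wd)
    (htw : ∃ q : ℚ, Wd.entireLFunction 1 / (Wd.realPeriodRat : ℂ) = (q : ℂ) ∧
      padicValRat 3 q = (padicValNat 3 Wd.shaOrder : ℤ) + padicValNat 3 Wd.tamagawaProduct -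
        2 * padicValNat 3 Wd.torsionOrder)
    (htam : padicValNat 3 Wd.tamagawaProduct = padicValNat 3 W.tamagawaProduct)
    (hu : padicValRat 3 (Cd.u : ℚ) = 0)
    (htamW : ¬ 3 ∣ W.tamagawaProduct)
    (hSW : ∀ [Finite W.sha], ¬ 3 ∣ W.shaOrder) (hSd : ∀ [Finite Wd.sha], ¬ 3 ∣ Wd.shaOrder)
    (ω : DirichletCharacter ℚ_[3] 3) (hω : KrizLi2019.IsTeichmullerCharacter ω)
    [Finite (AddCommGroup.torsion (W.baseChange K).toAffine.Point)]
    (crd : (W.baseChange K).toAffine.Point →+ ℤ) (g : (W.baseChange K).toAffine.Point)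
    (hg : crd g = 1) (hker : ∀ x, crd x = 0 → IsOfFinAddOrder x)
    (hiv : ∀ x : (W.baseChange K).toAffine.Point, 3 • x = 0 → x = 0)
    (hg0 : ‖Castella2018.padicLogOmega W 3 ιp g‖ = 1) :
    BSDp W 3 := by
  haveI : Fact (Nat.Prime 5) := ⟨by norm_num⟩
  haveI : Fact (Nat.Prime 59) := ⟨by norm_num⟩
  exact bsdp_three_of_unitRegime_prime_pair hKL hRem (q := 5) (r := 59) (by norm_num) (by norm_num)
    (by norm_num) (by norm_num) (by norm_num) (by norm_num)
    (by simp_rw [jacobiSym.legendreSym.to_jacobiSym]; exact certOne_five_fiftyNine)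
    (by simp_rw [jacobiSym.legendreSym.to_jacobiSym]; exact certTwo_five.1)
    (by simp_rw [jacobiSym.legendreSym.to_jacobiSym]; exact certTwo_five.2)
    W hm (by exact_mod_cast hW) (by exact_mod_cast h6) h2
    (fun ℓ hℓ hbad => by
      rcases hS ℓ hℓ hbad with h | h | h
      · exact Or.inl h
      · exact Or.inr (Or.inl h)
      · subst h; exact Or.inr (Or.inr ⟨by norm_num, by norm_num, by norm_num⟩))
    K hK (by rw [hdK]; norm_num) D H ι ιp P hGZ hKo hGZK hmod hP hr hLt Wd Cd hWd htw htam hu htamW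
    hSW hSd ω hω crd g hg hker hiv hg0

end Summit.BirchSwinnertonDyer.BirchSwinnertonDyer.Theorems.PrintCFram

end
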